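import Literature.NumberTheory.Sieve.FriedlanderIwaniecPrimes
import HarnessLib

/-!
# Friedlander–Iwaniec, *The polynomial `X² + Y⁴` captures its primes*: the local densities `ν(d)` and (3.16)

Family `parity`, statement parity.S17. Source: J. Friedlander, H. Iwaniec, Ann. of Math. (2) 148
(1998), 945–1040 [FriedlanderIwaniecAnnals1998], §3: (3.1) (the sequence `a_n = Σ_{a²+b²=n} 𝔷(b)`,
`𝔷` supported on squares, so that `A_d(x)` counts pairs `(a, c)` with `d ∣ a² + c⁴`), the function
`ρ(b; d) = #{α mod d : α² + b² ≡ 0}` with "`ρ(p^α) = 1 + χ₄(p)`" for odd `p`, and Lemma 3.4 with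
(3.16): `g(p) p = 1 + χ₄(p)(1 - 1/p)`, `g(p²) p² = 1 + ρ(p)(1 - 1/p)`, `g(4) = 1/4`.

`Literature.NumberTheory.Sieve.FriedlanderIwaniecPrimes` vendors the density `g` of (3.16) as a
bare multiplicative function (`fiDensity`, junk value `0` on `p^k`, `k ≥ 3`). This file supplies its
arithmetic meaning, the first ingredient of FI's Lemma 3.4 (and so of Proposition 3.5,
`FriedlanderIwaniec1998_prop35`, whose main term is `M_d(x) = d⁻¹ Σ_{(a,c)} ρ(c²; d)` with
`c`-average `ν(d)/d²`): the number of solutions of the defining congruence,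

  `ν(d) = #{(α, c) mod d : α² + c⁴ ≡ 0 (mod d)}`  (`fiNu`),

is multiplicative (`fiNu_mul_of_coprime`, Chinese remainder theorem), and on CUBEFREE moduli it
equals `g(d) d²`:

* `fiNu_prime` — `ν(p) = g(p) p²` (`ν(p) = 1 + (p-1)(1 + χ₄(p))` for odd `p`: fibre over `c`,
  `α ↦ α c⁻²`, and the tree's `fiRho_prime`; `ν(2) = 2`);
* `fiRho_prime_sq` — **`ρ(p²) = ρ(p)`** for odd `p` (FI's "`ρ(p^α) = 1 + χ₄(p)`" at `α = 2`:
  Hensel's lemma for the simple roots of `X² + 1`, by explicit lifting `β ↦ β + p t`);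
* `fiNu_prime_sq` — `ν(p²) = g(p²) p⁴` (`ν(p²) = p² + (p² - p) ρ(p)`: the `c` divisible by `p`
  contribute `p · p`, the units `c` contribute `ρ(p²)` each, `fiNu_prime_sq_eq`; `ν(4) = 4` matches
  the exceptional `g(4) = 1/4`);
* `fiNu_eq_fiDensity_mul_sq` — **`ν(d) = g(d) d²` for cubefree `d ≥ 1`**.

For non-cubefree `d` no such identity can hold with the tree's `g` (junk `0`), and `ν(p⁴) ≥ p⁵`
(the pairs `(p² a, p c)`) is the phenomenon behind `FriedlanderIwaniec1998_hyp28_false`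
(`FriedlanderIwaniecPrimesHyp28`).

## References

* J. Friedlander, H. Iwaniec, *The polynomial `X² + Y⁴` captures its primes*, Ann. of Math. (2)
  148 (1998), 945–1040, §3: (3.1), the displays defining `ρ(b; d)`, `ρ(d)` and "`ρ(p^α) = 1 + χ₄(p)`"
  before (3.2), and Lemma 3.4 with (3.16). [cite: FriedlanderIwaniecAnnals1998, §3 (3.16)]

## Mathlib / tree

Tree: `fiRho`, `fiRho_eq_card_zmod`, `fiRho_prime`, `fiDensity`, `fiDensity_apply`,
`fiDensity_prime`, `fiDensity_prime_sq`, `fiDensity_prime_pow`, `fiDensity_two`, `fiDensity_four`,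
`IsCubefree` (`FriedlanderIwaniecPrimes`). Mathlib: `ZMod.chineseRemainder`, `ZMod.unitOfCoprime`,
`ZMod.natCast_eq_zero_iff`, `ZMod.natCast_eq_natCast_iff'`,
`ArithmeticFunction.IsMultiplicative.multiplicative_factorization`, `Nat.prod_factorization_pow_eq_self`.
(`FriedlanderIwaniecPrimesCrudeBound` has the inequality half of the CRT for general root counts
`sqCongrCount`; here the counts are exact.)
-/

noncomputable section

open Finset

namespace Literature.NumberTheory.Sieve

/-- `ν(d) = #{(α, c) mod d : α² + c⁴ ≡ 0 (mod d)}`, the number of solutions of the defining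
congruence of `A_d` (FI §3: `A_d(x)` counts `(a, c)` with `d ∣ a² + c⁴`); `ν(0) = 0`.
[cite: FriedlanderIwaniecAnnals1998, §3, (3.1) and the definition of ρ(b; d)] -/
def fiNu (d : ℕ) : ℕ := #{x ∈ range d ×ˢ range d | d ∣ x.1 ^ 2 + x.2 ^ 4}

/-- `ν(1) = 1`. [folklore] -/
theorem fiNu_one : fiNu 1 = 1 := by decide

/-- `ν(2) = 2` (`= g(2)·4`, `g(2) = 1/2`). [folklore] -/
theorem fiNu_two : fiNu 2 = 2 := by decide

/-- `ν(4) = 4` (`= g(4)·16` with the exceptional value `g(4) = 1/4` of (3.16)). [folklore] -/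
theorem fiNu_four : fiNu 4 = 4 := by decide

/-- `ν(3) = 1` (`3 ≡ 3 (mod 4)`: only `(0, 0)`; `= g(3)·9`, `g(3) = 1/9`). [folklore] -/
theorem fiNu_three : fiNu 3 = 1 := by decide

/-- `ν(5) = 9` (`= g(5)·25`, `g(5) = 9/25`). [folklore] -/
theorem fiNu_five : fiNu 5 = 9 := by decide

/-- `ν(9) = 9` (`= g(9)·81`, `g(9) = 1/9`: `ρ(3) = 0`). [folklore] -/
theorem fiNu_nine : fiNu 9 = 9 := by decide

/-- `ν(d)` counted in `ZMod d` (`d ≠ 0`). [folklore] -/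
theorem fiNu_eq_card_zmod (d : ℕ) [NeZero d] :
    fiNu d = #{x : ZMod d × ZMod d | x.1 ^ 2 + x.2 ^ 4 = 0} := by
  unfold fiNu
  refine Finset.card_bij (fun x _ => ((x.1 : ZMod d), (x.2 : ZMod d))) ?_ ?_ ?_
  · intro x hx
    obtain ⟨-, hdvd⟩ := mem_filter.mp hx
    refine mem_filter.mpr ⟨mem_univ _, ?_⟩
    have h := (ZMod.natCast_eq_zero_iff (x.1 ^ 2 + x.2 ^ 4) d).mpr hdvd
    push_cast at h
    exact h
  · intro x hx y hy h
    have hx' := mem_product.mp (mem_filter.mp hx).1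
    have hy' := mem_product.mp (mem_filter.mp hy).1
    simp only [Prod.mk.injEq] at h
    have h1 := (ZMod.natCast_eq_natCast_iff' x.1 y.1 d).mp h.1
    have h2 := (ZMod.natCast_eq_natCast_iff' x.2 y.2 d).mp h.2
    rw [Nat.mod_eq_of_lt (mem_range.mp hx'.1), Nat.mod_eq_of_lt (mem_range.mp hy'.1)] at h1
    rw [Nat.mod_eq_of_lt (mem_range.mp hx'.2), Nat.mod_eq_of_lt (mem_range.mp hy'.2)] at h2
    exact Prod.ext h1 h2
  · intro a ha
    refine ⟨(a.1.val, a.2.val), mem_filter.mpr ⟨mem_product.mpr ⟨mem_range.mpr (ZMod.val_lt _),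
      mem_range.mpr (ZMod.val_lt _)⟩, ?_⟩, by simp⟩
    have h := (mem_filter.mp ha).2
    refine (ZMod.natCast_eq_zero_iff _ _).mp ?_
    push_cast
    simpa [ZMod.natCast_zmod_val] using h

/-- In a field `ZMod p`: `ν(p) = 1 + (p - 1) ρ(p)` where `ρ(p) = #{β : β² + 1 = 0}` (split the
count over `c = 0`, where only `α = 0`, and the units `c`, where `α ↦ α c⁻²` matches the roots of
`β² + 1`). [folklore] -/
theorem fiNu_prime_eq {p : ℕ} [Fact p.Prime] :
    fiNu p = 1 + (p - 1) * #{β : ZMod p | β ^ 2 + 1 = 0} := by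
  haveI : NeZero p := ⟨(Fact.out : p.Prime).ne_zero⟩
  rw [fiNu_eq_card_zmod]
  -- fibre over `c`
  have hsplit : #{x : ZMod p × ZMod p | x.1 ^ 2 + x.2 ^ 4 = 0} =
      ∑ c : ZMod p, #{α : ZMod p | α ^ 2 + c ^ 4 = 0} := by
    rw [card_eq_sum_ones, ← Finset.sum_fiberwise_of_maps_to (g := Prod.snd) (t := univ) (fun _ _ => mem_univ _)]
    refine Finset.sum_congr rfl fun c _ => ?_
    rw [card_eq_sum_ones]
    refine Finset.sum_bij (fun x _ => x.1) ?_ ?_ ?_ ?_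
    · intro x hx
      simp only [mem_filter, mem_univ, true_and] at hx ⊢
      rw [← hx.2]; exact hx.1
    · intro x hx y hy h
      simp only [mem_filter, mem_univ, true_and] at hx hy
      exact Prod.ext h (hx.2.trans hy.2.symm)
    · intro α hα
      refine ⟨(α, c), ?_, rfl⟩
      simp only [mem_filter, mem_univ, true_and] at hα ⊢
      exact ⟨hα, trivial⟩
    · intros; rfl
  rw [hsplit, ← Finset.sum_erase_add _ _ (mem_univ (0 : ZMod p))]
  -- `c = 0`: only `α = 0`
  have h0 : #{α : ZMod p | α ^ 2 + (0 : ZMod p) ^ 4 = 0} = 1 := by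
    rw [Finset.card_eq_one]
    refine ⟨0, ?_⟩
    ext α
    simp [pow_eq_zero_iff]
  rw [h0, add_comm]
  congr 1
  -- units `c`: the count is `ρ(p)` each
  have hc : ∀ c ∈ (univ : Finset (ZMod p)).erase 0,
      #{α : ZMod p | α ^ 2 + c ^ 4 = 0} = #{β : ZMod p | β ^ 2 + 1 = 0} := by
    intro c hc
    have hc0 : c ≠ 0 := (mem_erase.mp hc).1
    have hc2 : c ^ 2 ≠ 0 := pow_ne_zero 2 hc0
    refine Finset.card_bij (fun α _ => α * (c ^ 2)⁻¹) ?_ ?_ ?_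
    · intro α hα
      simp only [mem_filter, mem_univ, true_and] at hα ⊢
      have : (α * (c ^ 2)⁻¹) ^ 2 + 1 = (α ^ 2 + c ^ 4) * ((c ^ 2)⁻¹) ^ 2 := by
        field_simp
      rw [this, hα, zero_mul]
    · intro α _ α' _ h
      simpa [mul_eq_mul_right_iff, inv_eq_zero, hc2] using h
    · intro β hβ
      refine ⟨β * c ^ 2, ?_, by field_simp⟩
      simp only [mem_filter, mem_univ, true_and] at hβ ⊢
      have : (β * c ^ 2) ^ 2 + c ^ 4 = (β ^ 2 + 1) * c ^ 4 := by ring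
      rw [this, hβ, zero_mul]
  rw [Finset.sum_congr rfl hc, sum_const, smul_eq_mul, card_erase_of_mem (mem_univ _), card_univ,
    ZMod.card]

/-- **`ν(p) = g(p) p²`** for primes `p` ((3.16): `g(p) p = 1 + χ₄(p)(1 - 1/p)`, and
`ν(p) = 1 + (p-1)(1 + χ₄(p))` for odd `p`, `ν(2) = 2`). [cite: FriedlanderIwaniecAnnals1998, (3.16)] -/
theorem fiNu_prime {p : ℕ} (hp : p.Prime) : (fiNu p : ℝ) = fiDensity p * (p : ℝ) ^ 2 := by
  by_cases hp2 : p = 2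
  · subst hp2; rw [fiNu_two, fiDensity_two]; norm_num
  haveI : Fact p.Prime := ⟨hp⟩
  have hρ : (#{β : ZMod p | β ^ 2 + 1 = 0} : ℝ) = 1 + (ZMod.χ₄ p : ℝ) := by
    haveI : NeZero p := ⟨hp.ne_zero⟩
    have h := fiRho_prime hp hp2
    rw [fiRho_eq_card_zmod] at h
    exact_mod_cast h
  have hp1 : 1 ≤ p := hp.one_le
  rw [fiNu_prime_eq, fiDensity_prime hp]
  push_cast [Nat.cast_sub hp1]
  rw [hρ]
  have hp0 : (p : ℝ) ≠ 0 := by exact_mod_cast hp.ne_zero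
  field_simp
  ring


/-- `ν(0) = 0`. [folklore] -/
theorem fiNu_zero : fiNu 0 = 0 := by simp [fiNu]

/-- **`ν` is multiplicative** (Chinese remainder theorem). [folklore] -/
theorem fiNu_mul_of_coprime {m n : ℕ} (h : m.Coprime n) : fiNu (m * n) = fiNu m * fiNu n := by
  rcases Nat.eq_zero_or_pos m with rfl | hm
  · simp [fiNu_zero]
  rcases Nat.eq_zero_or_pos n with rfl | hn
  · simp [fiNu_zero]
  haveI : NeZero m := ⟨hm.ne'⟩
  haveI : NeZero n := ⟨hn.ne'⟩
  haveI : NeZero (m * n) := ⟨(Nat.mul_pos hm hn).ne'⟩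
  rw [fiNu_eq_card_zmod, fiNu_eq_card_zmod, fiNu_eq_card_zmod, ← Fintype.card_subtype,
    ← Fintype.card_subtype, ← Fintype.card_subtype, ← Fintype.card_prod]
  set e := ZMod.chineseRemainder h with he
  -- componentwise reading of the congruence
  have key : ∀ α c : ZMod (m * n), α ^ 2 + c ^ 4 = 0 ↔
      ((e α).1 ^ 2 + (e c).1 ^ 4 = 0 ∧ (e α).2 ^ 2 + (e c).2 ^ 4 = 0) := by
    intro α c
    have h1 : e (α ^ 2 + c ^ 4) = ((e α).1 ^ 2 + (e c).1 ^ 4, (e α).2 ^ 2 + (e c).2 ^ 4) := by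
      rw [map_add, map_pow, map_pow]; rfl
    constructor
    · intro h0
      have := congrArg e h0
      rw [h1, map_zero, Prod.ext_iff] at this
      exact this
    · rintro ⟨ha, hb⟩
      apply e.injective
      rw [h1, map_zero, Prod.ext_iff]
      exact ⟨ha, hb⟩
  refine Fintype.card_congr
    { toFun := fun x => (⟨((e x.1.1).1, (e x.1.2).1), ((key _ _).mp x.2).1⟩,
        ⟨((e x.1.1).2, (e x.1.2).2), ((key _ _).mp x.2).2⟩)
      invFun := fun yz => ⟨(e.symm (yz.1.1.1, yz.2.1.1), e.symm (yz.1.1.2, yz.2.1.2)), by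
        rw [key]
        simp only [RingEquiv.apply_symm_apply]
        exact ⟨yz.1.2, yz.2.2⟩⟩
      left_inv := fun x => by
        apply Subtype.ext
        simp only
        ext <;> simp
      right_inv := fun yz => by
        obtain ⟨⟨⟨a1, c1⟩, h1⟩, ⟨⟨a2, c2⟩, h2⟩⟩ := yz
        simp }


/-! ### Hensel: `ρ(p²) = ρ(p)` for odd primes -/

/-- For an odd prime `p`, the roots of `β² + 1 ≡ 0 (mod p²)` in `[0, p²)` correspond bijectively
(by reduction mod `p`) to the roots mod `p`: **`ρ(p²) = ρ(p)`** (FI §3: "`ρ(p^α) = 1 + χ₄(p)`";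
Hensel's lemma for the simple roots of `X² + 1`). [cite: FriedlanderIwaniecAnnals1998, §3, display "ρ(p^α) = 1 + χ₄(p)" before (3.2)] -/
theorem fiRho_prime_sq {p : ℕ} (hp : p.Prime) (hp2 : p ≠ 2) : fiRho (p ^ 2) = fiRho p := by
  have hp0 : 0 < p := hp.pos
  have hp1 : 1 < p := hp.one_lt
  have hpodd : ¬p ∣ 2 := fun h => hp2 ((Nat.prime_dvd_prime_iff_eq hp Nat.prime_two).mp h)
  haveI : Fact p.Prime := ⟨hp⟩
  unfold fiRho
  -- a root mod `p` is nonzero mod `p`, and `2β` is a unit mod `p`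
  have hunit : ∀ β : ℕ, p ∣ β ^ 2 + 1 → ((2 * β : ℕ) : ZMod p) ≠ 0 := by
    intro β hβ h0
    have h2 : ((2 : ℕ) : ZMod p) ≠ 0 := by
      rw [Ne, ZMod.natCast_eq_zero_iff]; exact hpodd
    have hb : ((β : ℕ) : ZMod p) ≠ 0 := by
      intro hb0
      rw [ZMod.natCast_eq_zero_iff] at hb0
      have : p ∣ 1 := by
        have h1 : p ∣ β ^ 2 := dvd_pow hb0 two_ne_zero
        exact (Nat.dvd_add_right h1).mp hβ
      exact hp.one_lt.ne' (Nat.dvd_one.mp this)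
    rw [Nat.cast_mul] at h0
    rcases mul_eq_zero.mp h0 with h | h
    · exact h2 h
    · exact hb h
  refine Finset.card_bij (fun α _ => α % p) ?_ ?_ ?_
  · -- maps roots mod `p²` to roots mod `p`
    intro α hα
    obtain ⟨-, hdvd⟩ := mem_filter.mp hα
    refine mem_filter.mpr ⟨mem_range.mpr (Nat.mod_lt _ hp0), ?_⟩
    have h1 : p ∣ α ^ 2 + 1 := (dvd_pow_self p two_ne_zero).trans hdvd
    rw [Nat.dvd_iff_mod_eq_zero] at h1 ⊢
    rw [Nat.add_mod, Nat.pow_mod, Nat.mod_mod, ← Nat.pow_mod, ← Nat.add_mod, h1]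
  · -- injective
    intro α₁ hα₁ α₂ hα₂ h
    obtain ⟨hr1, hd1⟩ := mem_filter.mp hα₁
    obtain ⟨hr2, hd2⟩ := mem_filter.mp hα₂
    have hlt1 := mem_range.mp hr1
    have hlt2 := mem_range.mp hr2
    set β := α₁ % p with hβ
    have e1 : α₁ = β + p * (α₁ / p) := (Nat.mod_add_div α₁ p).symm
    have e2 : α₂ = β + p * (α₂ / p) := by
      have := (Nat.mod_add_div α₂ p).symm
      rwa [← h] at this
    set t₁ := α₁ / p with ht₁
    set t₂ := α₂ / p with ht₂
    have ht1p : t₁ < p := Nat.div_lt_of_lt_mul (by simpa [pow_two] using hlt1)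
    have ht2p : t₂ < p := Nat.div_lt_of_lt_mul (by simpa [pow_two] using hlt2)
    have hβroot : p ∣ β ^ 2 + 1 := by
      have h1 : p ∣ α₁ ^ 2 + 1 := (dvd_pow_self p two_ne_zero).trans hd1
      rw [Nat.dvd_iff_mod_eq_zero] at h1 ⊢
      rw [hβ, Nat.add_mod, Nat.pow_mod, Nat.mod_mod, ← Nat.pow_mod, ← Nat.add_mod, h1]
    -- in `ℤ`: `p² ∣ α₁² - α₂² = p (t₁ - t₂) (2β + p (t₁ + t₂))`
    have hZ : ((p : ℤ) ^ 2) ∣ ((α₁ : ℤ) ^ 2 + 1) - ((α₂ : ℤ) ^ 2 + 1) :=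
      dvd_sub (by exact_mod_cast hd1) (by exact_mod_cast hd2)
    have hfac : ((α₁ : ℤ) ^ 2 + 1) - ((α₂ : ℤ) ^ 2 + 1) =
        (p : ℤ) * (((t₁ : ℤ) - t₂) * (2 * β + p * (t₁ + t₂))) := by
      have e1' : (α₁ : ℤ) = β + p * t₁ := by exact_mod_cast e1
      have e2' : (α₂ : ℤ) = β + p * t₂ := by exact_mod_cast e2
      rw [e1', e2']; ring
    rw [hfac, pow_two] at hZ
    have hpZ : (p : ℤ) ≠ 0 := by exact_mod_cast hp.ne_zero
    have hZ' : (p : ℤ) ∣ ((t₁ : ℤ) - t₂) * (2 * β + p * (t₁ + t₂)) := (mul_dvd_mul_iff_left hpZ).mp hZ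
    have hpP : Prime (p : ℤ) := Nat.prime_iff_prime_int.mp hp
    rcases hpP.dvd_or_dvd hZ' with h1 | h1
    · -- `p ∣ t₁ - t₂` with `|t₁ - t₂| < p`
      have : (t₁ : ℤ) = t₂ := by
        obtain ⟨k, hk⟩ := h1
        have hk1 : ((t₁ : ℤ) - t₂) < p := by
          have : (t₁ : ℤ) < p := by exact_mod_cast ht1p
          linarith [(Nat.cast_nonneg t₂ : (0 : ℤ) ≤ t₂)]
        have hk2 : -(p : ℤ) < (t₁ : ℤ) - t₂ := by
          have : (t₂ : ℤ) < p := by exact_mod_cast ht2p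
          linarith [(Nat.cast_nonneg t₁ : (0 : ℤ) ≤ t₁)]
        rw [hk] at hk1 hk2
        have hp0' : (0 : ℤ) < p := by exact_mod_cast hp0
        have hk3 : k < 1 := by
          by_contra hc; rw [not_lt] at hc
          have : (p : ℤ) * 1 ≤ p * k := mul_le_mul_of_nonneg_left hc hp0'.le
          linarith
        have hk4 : -1 < k := by
          by_contra hc; rw [not_lt] at hc
          have : (p : ℤ) * k ≤ p * (-1) := mul_le_mul_of_nonneg_left hc hp0'.le
          linarith
        have hk0 : k = 0 := by omega
        rw [hk0, mul_zero] at hk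
        linarith
      have : t₁ = t₂ := by exact_mod_cast this
      rw [e1, e2, this]
    · -- `p ∣ 2β + p(t₁ + t₂)` forces `p ∣ 2β`: impossible
      exfalso
      have h2 : (p : ℤ) ∣ 2 * (β : ℤ) := by
        have := dvd_sub h1 (dvd_mul_right (p : ℤ) ((t₁ : ℤ) + t₂))
        simpa using this
      apply hunit β hβroot
      rw [ZMod.natCast_eq_zero_iff]
      exact_mod_cast Int.natCast_dvd_natCast.mp (by exact_mod_cast h2 : ((p : ℕ) : ℤ) ∣ ((2 * β : ℕ) : ℤ))
  · -- surjective: lift a root `β` mod `p` to `α = β + p t`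
    intro β hβ
    obtain ⟨hβr, hβd⟩ := mem_filter.mp hβ
    have hβp := mem_range.mp hβr
    obtain ⟨q, hq⟩ := hβd
    -- `t` solves `2 β t ≡ -q (mod p)`
    set t : ℕ := ((-(q : ZMod p)) * (((2 * β : ℕ) : ZMod p))⁻¹).val with ht
    have htp : t < p := ZMod.val_lt _
    have hkey : (((q + 2 * β * t : ℕ)) : ZMod p) = 0 := by
      have hu := hunit β ⟨q, hq⟩
      push_cast
      rw [ht, ZMod.natCast_zmod_val]
      field_simp
      push_cast
      ring
    refine ⟨β + p * t, mem_filter.mpr ⟨mem_range.mpr ?_, ?_⟩, ?_⟩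
    · -- `β + p t < p²`
      calc β + p * t ≤ (p - 1) + p * (p - 1) := by
            have : t ≤ p - 1 := by omega
            have : β ≤ p - 1 := by omega
            gcongr
        _ < p ^ 2 := by
            have : (p - 1) + p * (p - 1) + 1 = p ^ 2 := by
              cases p with
              | zero => omega
              | succ k => simp [pow_two]; ring
            omega
    · -- `p² ∣ (β + p t)² + 1 = p (q + 2 β t) + p² t²`
      have e : (β + p * t) ^ 2 + 1 = p * (q + 2 * β * t) + p ^ 2 * t ^ 2 := by
        have : β ^ 2 + 1 = p * q := hq
        nlinarith [this]
      rw [e]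
      refine dvd_add ?_ (dvd_mul_right _ _)
      have hdq : p ∣ q + 2 * β * t := (ZMod.natCast_eq_zero_iff _ _).mp hkey
      obtain ⟨r, hr⟩ := hdq
      rw [hr, ← mul_assoc, ← pow_two]
      exact dvd_mul_right _ _
    · -- reduces to `β`
      rw [Nat.add_mul_mod_self_left, Nat.mod_eq_of_lt hβp]


/-! ### `ν(p²)` -/

/-- Fibrewise: `ν(d) = Σ_{c mod d} #{α mod d : d ∣ α² + c⁴}`. [folklore] -/
theorem fiNu_eq_sum (d : ℕ) : fiNu d = ∑ c ∈ range d, #{α ∈ range d | d ∣ α ^ 2 + c ^ 4} := by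
  unfold fiNu
  rw [Finset.card_filter, Finset.sum_product_right]
  refine Finset.sum_congr rfl fun c _ => ?_
  rw [Finset.card_filter]

/-- `#{α ∈ [0, p·m) : p ∣ α} = m`. [folklore] -/
theorem card_range_mul_filter_dvd {p : ℕ} (hp : 0 < p) (m : ℕ) :
    #{α ∈ range (p * m) | p ∣ α} = m := by
  have h := Finset.card_bij (s := range m) (t := {α ∈ range (p * m) | p ∣ α}) (fun t _ => p * t)
    (fun t ht => mem_filter.mpr ⟨mem_range.mpr (Nat.mul_lt_mul_of_pos_left (mem_range.mp ht) hp),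
      dvd_mul_right _ _⟩)
    (fun t₁ _ t₂ _ h => Nat.eq_of_mul_eq_mul_left hp h)
    (fun α hα => by
      obtain ⟨hαr, ⟨t, rfl⟩⟩ := mem_filter.mp hα
      exact ⟨t, mem_range.mpr (Nat.lt_of_mul_lt_mul_left (mem_range.mp hαr)), rfl⟩)
  rw [card_range] at h
  exact h.symm

/-- For `p ∣ c`: `#{α mod p² : p² ∣ α² + c⁴} = p` (the condition is `p ∣ α`). [folklore] -/
theorem card_filter_sq_add_pow_four_of_dvd {p : ℕ} (hp : p.Prime) {c : ℕ} (hpc : p ∣ c) :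
    #{α ∈ range (p ^ 2) | p ^ 2 ∣ α ^ 2 + c ^ 4} = p := by
  have hc4 : p ^ 2 ∣ c ^ 4 := by
    calc p ^ 2 ∣ p ^ 4 := pow_dvd_pow p (by norm_num)
      _ ∣ c ^ 4 := pow_dvd_pow_of_dvd hpc 4
  have hiff : ∀ α : ℕ, p ^ 2 ∣ α ^ 2 + c ^ 4 ↔ p ∣ α := by
    intro α
    rw [Nat.dvd_add_left hc4, Nat.pow_dvd_pow_iff two_ne_zero]
  rw [Finset.filter_congr (fun α _ => hiff α), pow_two]
  exact card_range_mul_filter_dvd hp.pos p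

/-- For `p ∤ c`: `#{α mod p² : p² ∣ α² + c⁴} = ρ(p²)` (`α = β c²` matches the roots of `β² + 1`).
[folklore] -/
theorem card_filter_sq_add_pow_four_of_not_dvd {p : ℕ} (hp : p.Prime) {c : ℕ} (hpc : ¬p ∣ c) :
    #{α ∈ range (p ^ 2) | p ^ 2 ∣ α ^ 2 + c ^ 4} = fiRho (p ^ 2) := by
  haveI : NeZero (p ^ 2) := ⟨pow_ne_zero 2 hp.ne_zero⟩
  have hcop : c.Coprime (p ^ 2) := Nat.Coprime.pow_right 2 ((Nat.Prime.coprime_iff_not_dvd hp).mpr hpc).symm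
  set u : (ZMod (p ^ 2))ˣ := ZMod.unitOfCoprime c hcop with hu
  have huc : ((u : (ZMod (p ^ 2))ˣ) : ZMod (p ^ 2)) = (c : ZMod (p ^ 2)) := ZMod.coe_unitOfCoprime c hcop
  set v : ZMod (p ^ 2) := ((u⁻¹ : (ZMod (p ^ 2))ˣ) : ZMod (p ^ 2)) with hv
  have huv : (c : ZMod (p ^ 2)) * v = 1 := by rw [← huc, hv, Units.mul_inv]
  unfold fiRho
  symm
  -- `β ↦ (β c²) mod p²`
  refine Finset.card_bij (fun β _ => ((β : ZMod (p ^ 2)) * (c : ZMod (p ^ 2)) ^ 2).val) ?_ ?_ ?_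
  · intro β hβ
    obtain ⟨-, hβd⟩ := mem_filter.mp hβ
    refine mem_filter.mpr ⟨mem_range.mpr (ZMod.val_lt _), ?_⟩
    rw [← ZMod.natCast_eq_zero_iff]
    have h0 : ((β : ZMod (p ^ 2)) ^ 2 + 1) = 0 := by
      have := (ZMod.natCast_eq_zero_iff (β ^ 2 + 1) (p ^ 2)).mpr hβd
      push_cast at this; exact this
    push_cast
    rw [ZMod.natCast_zmod_val]
    have : ((β : ZMod (p ^ 2)) * (c : ZMod (p ^ 2)) ^ 2) ^ 2 + (c : ZMod (p ^ 2)) ^ 4 =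
        ((β : ZMod (p ^ 2)) ^ 2 + 1) * (c : ZMod (p ^ 2)) ^ 4 := by ring
    rw [this, h0, zero_mul]
  · intro β₁ hβ₁ β₂ hβ₂ h
    have hlt1 := mem_range.mp (mem_filter.mp hβ₁).1
    have hlt2 := mem_range.mp (mem_filter.mp hβ₂).1
    have h' : (β₁ : ZMod (p ^ 2)) * (c : ZMod (p ^ 2)) ^ 2 = (β₂ : ZMod (p ^ 2)) * (c : ZMod (p ^ 2)) ^ 2 :=
      ZMod.val_injective _ h
    have h'' : (β₁ : ZMod (p ^ 2)) = (β₂ : ZMod (p ^ 2)) := by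
      have : (β₁ : ZMod (p ^ 2)) * (c : ZMod (p ^ 2)) ^ 2 * v ^ 2 = (β₂ : ZMod (p ^ 2)) * (c : ZMod (p ^ 2)) ^ 2 * v ^ 2 := by
        rw [h']
      have e : ∀ β : ZMod (p ^ 2), β * (c : ZMod (p ^ 2)) ^ 2 * v ^ 2 = β := fun β => by
        rw [mul_assoc, ← mul_pow, huv, one_pow, mul_one]
      rwa [e, e] at this
    have := (ZMod.natCast_eq_natCast_iff' β₁ β₂ (p ^ 2)).mp h''
    rwa [Nat.mod_eq_of_lt hlt1, Nat.mod_eq_of_lt hlt2] at this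
  · intro α hα
    obtain ⟨-, hαd⟩ := mem_filter.mp hα
    have hαlt := mem_range.mp (mem_filter.mp hα).1
    refine ⟨((α : ZMod (p ^ 2)) * v ^ 2).val, mem_filter.mpr ⟨mem_range.mpr (ZMod.val_lt _), ?_⟩, ?_⟩
    · rw [← ZMod.natCast_eq_zero_iff]
      have h0 : ((α : ZMod (p ^ 2)) ^ 2 + (c : ZMod (p ^ 2)) ^ 4) = 0 := by
        have := (ZMod.natCast_eq_zero_iff (α ^ 2 + c ^ 4) (p ^ 2)).mpr hαd
        push_cast at this; exact this
      push_cast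
      rw [ZMod.natCast_zmod_val]
      have h1 : (c : ZMod (p ^ 2)) ^ 4 * v ^ 4 = 1 := by rw [← mul_pow, huv, one_pow]
      have e : ((α : ZMod (p ^ 2)) * v ^ 2) ^ 2 + 1 =
          ((α : ZMod (p ^ 2)) ^ 2 + (c : ZMod (p ^ 2)) ^ 4) * v ^ 4 := by
        linear_combination (-1 : ZMod (p ^ 2)) * h1
      rw [e, h0, zero_mul]
    · show (((((α : ZMod (p ^ 2)) * v ^ 2).val : ℕ) : ZMod (p ^ 2)) * (c : ZMod (p ^ 2)) ^ 2).val = α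
      rw [ZMod.natCast_zmod_val, mul_assoc, ← mul_pow, mul_comm v, huv, one_pow, mul_one,
        ZMod.val_natCast, Nat.mod_eq_of_lt hαlt]

/-- `#{c ∈ [0, p²) : p ∣ c} = p`. [folklore] -/
theorem card_range_sq_filter_dvd {p : ℕ} (hp : 0 < p) : #{c ∈ range (p ^ 2) | p ∣ c} = p := by
  rw [pow_two]; exact card_range_mul_filter_dvd hp p

/-- **`ν(p²) = p² + (p² - p) ρ(p)`** for odd primes `p`. [folklore] -/
theorem fiNu_prime_sq_eq {p : ℕ} (hp : p.Prime) (hp2 : p ≠ 2) :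
    fiNu (p ^ 2) = p ^ 2 + (p ^ 2 - p) * fiRho p := by
  rw [fiNu_eq_sum, ← Finset.sum_filter_add_sum_filter_not (range (p ^ 2)) (fun c => p ∣ c)]
  have h1 : ∑ c ∈ (range (p ^ 2)).filter (fun c => p ∣ c), #{α ∈ range (p ^ 2) | p ^ 2 ∣ α ^ 2 + c ^ 4} =
      p ^ 2 := by
    rw [Finset.sum_congr rfl (g := fun _ => p) fun c hc =>
      card_filter_sq_add_pow_four_of_dvd hp (mem_filter.mp hc).2, sum_const, smul_eq_mul,
      card_range_sq_filter_dvd hp.pos, pow_two]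
  have h2 : ∑ c ∈ (range (p ^ 2)).filter (fun c => ¬p ∣ c), #{α ∈ range (p ^ 2) | p ^ 2 ∣ α ^ 2 + c ^ 4} =
      (p ^ 2 - p) * fiRho p := by
    rw [Finset.sum_congr rfl (g := fun _ => fiRho p) fun c hc => by
      rw [card_filter_sq_add_pow_four_of_not_dvd hp (mem_filter.mp hc).2, fiRho_prime_sq hp hp2],
      sum_const, smul_eq_mul]
    congr 1
    have := Finset.card_filter_add_card_filter_not (s := range (p ^ 2)) (fun c => p ∣ c)
    rw [card_range_sq_filter_dvd hp.pos, card_range] at this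
    omega
  rw [h1, h2]

/-- **`ν(p²) = g(p²) p⁴`** for all primes `p` ((3.16): `g(p²) p² = 1 + ρ(p)(1 - 1/p)`, `g(4) = 1/4`).
[cite: FriedlanderIwaniecAnnals1998, (3.16)] -/
theorem fiNu_prime_sq {p : ℕ} (hp : p.Prime) :
    (fiNu (p ^ 2) : ℝ) = fiDensity (p ^ 2) * ((p : ℝ) ^ 2) ^ 2 := by
  by_cases hp2 : p = 2
  · subst hp2
    rw [show (2 : ℕ) ^ 2 = 4 by norm_num, fiNu_four, fiDensity_four]; norm_num
  rw [fiNu_prime_sq_eq hp hp2, fiDensity_prime_sq hp hp2]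
  have hp1 : p ≤ p ^ 2 := by nlinarith [hp.one_lt]
  push_cast [Nat.cast_sub hp1]
  have hp0 : (p : ℝ) ≠ 0 := by exact_mod_cast hp.ne_zero
  field_simp


/-! ### `ν(d) = g(d) d²` on cubefree moduli -/

/-- `ν` as an arithmetic function. [folklore] -/
def fiNuArith : ArithmeticFunction ℕ := ⟨fiNu, fiNu_zero⟩

/-- `ν` is a multiplicative arithmetic function. [folklore] -/
theorem isMultiplicative_fiNuArith : fiNuArith.IsMultiplicative :=
  ⟨fiNu_one, fun h => fiNu_mul_of_coprime h⟩

/-- **The density of (3.16) is the local density of `a_n`**: for cubefree `d ≥ 1`,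
`ν(d) = g(d) d²`, i.e. `g(d) = #{(α, c) mod d : α² + c⁴ ≡ 0 (d)} / d²` — including the
"exceptional" value `g(4) = 1/4`. (For non-cubefree `d` the tree's `g` takes the junk value `0`,
while e.g. `ν(p⁴) ≥ p⁵`: the moduli `d = p⁴` of `FriedlanderIwaniec1998_hyp28_false`.)
[cite: FriedlanderIwaniecAnnals1998, (3.16) and Lemma 3.4] -/
theorem fiNu_eq_fiDensity_mul_sq {d : ℕ} (hd : IsCubefree d) (hd0 : d ≠ 0) :
    (fiNu d : ℝ) = fiDensity d * (d : ℝ) ^ 2 := by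
  have h1 : fiNu d = d.factorization.prod fun p k => fiNu (p ^ k) :=
    isMultiplicative_fiNuArith.multiplicative_factorization fiNuArith hd0
  have h2 : fiDensity d = d.factorization.prod fun p k => fiDensityPrimePow p k := fiDensity_apply hd0
  have h3 : ((d : ℝ)) ^ 2 = (d.factorization.prod fun p k => ((p : ℝ) ^ k) ^ 2) := by
    conv_lhs => rw [← Nat.prod_factorization_pow_eq_self hd0]
    rw [Finsupp.prod, Finsupp.prod, Nat.cast_prod, ← Finset.prod_pow]
    push_cast
    rfl
  rw [h1, h2, h3, Finsupp.prod, Finsupp.prod, Finsupp.prod, Nat.cast_prod, ← Finset.prod_mul_distrib]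
  refine Finset.prod_congr rfl fun p hp => ?_
  have hpp : p.Prime := Nat.prime_of_mem_primeFactors (Nat.support_factorization d ▸ hp)
  have hk1 : 1 ≤ d.factorization p := Nat.pos_of_ne_zero (Finsupp.mem_support_iff.mp hp)
  have hk2 : d.factorization p ≤ 2 := hd p (Nat.support_factorization d ▸ hp)
  rw [← fiDensity_prime_pow hpp]
  interval_cases h : d.factorization p
  · rw [pow_one, pow_one]; exact fiNu_prime hpp
  · exact fiNu_prime_sq hpp

end Literature.NumberTheory.Sieve
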